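import Mathlib
import HarnessLib
import HarnessLib.Audit
import Summits.ABC.Statement
import Literature.NumberTheory.DiophantineGeometry.MultiplicativeGroupApproximation
import Literature.NumberTheory.DiophantineGeometry.AbcValuationProduct
import HarnessLib.Audit.Status.Attr

/-!
Route: RootDecompD

# Route RootDecompD — Root decomposition D (TopExponentSplit, lens 4) — abc splits along the top
exponent into forgiven roots of c and power-free cells

It suffices to show X = ExponentForgivenABC ∧ BoundedExponentABC (root decomposition node of cell
decomp-abc, lens 4
«structured-vs-generic radical split», generation 2; no card realised). Write e(T) := max_p ν_p(abc)
for the TOP EXPONENT of an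
abc triple T = (a,b,c) (inlined as `(a*b*c).primeFactors.sup fun p => (a*b*c).factorization p`); it
is the one invariant that
controls the free information exactly (c² ≤ 2·abc ≤ 2·rad(abc)^{e(T)}). H = BoundedExponentABC
(GENERIC side, attacked conjunct):
for every k, abc on the cell {e(T) ≤ k} = abc for triples all of whose members are (k+1)-free (K may
depend on k). F =
ExponentForgivenABC (STRUCTURED side): for some m and every δ > 0, c < K·c^{m/e(T)}·rad(abc)^{1+δ}
for EVERY triple — abc with
the e(T)-th root of c (to the power m) forgiven; free on {e ≤ m}, biting only on power-like triples,
with a cushion that shrinks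
as e(T) grows. The node is exact: ABC ⟺ F ∧ H (kernel, `node_iff` in the draft).
Lean: `(∃ m : ℕ, ∀ δ : ℝ, 0 < δ → ∃ K : ℝ, 0 < K ∧ ∀ a b c : ℕ,
Literature.NumberTheory.DiophantineGeometry.IsABCTriple a b c → (c : ℝ) < K * (c : ℝ) ^ ((m : ℝ) /
((((a * b * c).primeFactors.sup fun p => (a * b * c).factorization p : ℕ) : ℝ))) *
((Literature.NumberTheory.DiophantineGeometry.rad a b c : ℕ) : ℝ) ^ (1 + δ)) ∧ (∀ k : ℕ, ∀ ε : ℝ, 0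
< ε → ∃ K : ℝ, 0 < K ∧ ∀ a b c : ℕ, Literature.NumberTheory.DiophantineGeometry.IsABCTriple a b c →
((a * b * c).primeFactors.sup fun p => (a * b * c).factorization p) ≤ k → (c : ℝ) < K *
((Literature.NumberTheory.DiophantineGeometry.rad a b c : ℕ) : ℝ) ^ (1 + ε))`

## Assembly
Deciding theorem `closes : ExponentForgivenABC → BoundedExponentABC → ABC` (glue.lean,
self-contained, ≈ 90 lines of real-exponent
bookkeeping): given ε ≤ 1 take m from F, apply H on the cell e(T) ≤ ⌊3m/ε⌋ at ε/3 and F at δ = ε/3;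
a triple with c^{ε/3} ≤ c^{m/e(T)}
is in that cell (heavy case, exponent 1 + ε/3 ≤ 1 + ε); otherwise c < K₂·c^{ε/3}·R^{1+ε/3}, so
c^{1−ε/3} < K₂ R^{1+ε/3} and
c < K₂^{1/(1−ε/3)}·R^{(1+ε/3)/(1−ε/3)} ≤ K'·R^{1+ε}. Both binders are load-bearing; the AND is exact
(`node_iff`).

Rationale: WHY THIS LINE. The forgiving-split schema is free: for ANY weight X(T) ≥ 1, ABC ⟺ (abc on the
X-heavy cells {X ≥ c^ε}) ∧ (abc with X forgiven)
(kernel: `abc_iff_heavy_and_forgiven`), and at X_m = c^{m/e(T)} the heavy cells are LITERALLY the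
bounded-exponent cells
(`boundedExponent_iff_heavy`), so the lens's structured/generic dichotomy becomes an exact AND with
both sides necessary
(`boundedExponent_of_abc`, `exponentForgiven_of_abc`). What is imported: on the structured side,
Baker–Pasten (linear forms in
logarithms + Shimura-curve valuation bounds, Pasten2024 Thm 1.4 via the tree facts
`evertseGyory_thm_4_2_1_rat`, `pasten2024_thm_2_5`)
already proves F's sub-exponential analogue `TopExponentSubexp` (kernel: a prime of top exponent is
≤ c^{1/e(T)}, fed into Pasten's
log c < p₀·B^{13}); on the generic side, Diophantine approximation (Thue–Siegel / hypergeometric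
method: Bennett2001, BakerStewart1988,
Bugeaud2004 §2.2, EvertseGyory2015) owns the first open cell: the kernel reduction
`fourFreeBelowThreeHalves_of_uniformCubicThue` turns
«beat the free exponent 3/2 on 4-free triples» into a uniform binomial cubic Thue inequality, the
binomial-cubic fibre of Langevin's
abc ⟺ uniform-Roth reformulation (BombieriGubler2006 Thm 12.2.12, Langevin1993). What it does that
prior routes do not: RootDecompA
(lens 3) forgives the y-SMOOTH PART S_y(abc) (a place cut) and its g2 splits by archimedean
lopsidedness; RootDecompB (lens 6) is
Kummer descent at the frozen level 5 with a residual cell containing {e ≤ 4}; the retired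
GiantExponentRegime / FermatTwistHeights
isolate one huge pure power. Nobody cuts on the MULTIPLICITY axis e(T) with a ROOT of c as the
forgiven weight, and no route reaches a
Thue inequality; the negatives index has no statement about exponent cells, prime-power c or Thue
inequalities.
Workshop record (writer decomp-abc-writer-1-g0, cell decomp-abc, LADDER-abc rung 0, D-0178): this is
root node TopExponentSplit of lens 4 (NODE 2026-08-30T02:12:06Z; lens draft file
TopExponentSplit.lean sha256 8cf38139bb7e7a8a15b603066ea78d5fd5f65d9231664f3fe26d50f526deabd2;
NODE.md sha256 n/a), adopted as OR-sibling RootDecompD of the root decomposition; critic CLEARED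
decomp-abc-crit-1-g0 2026-08-30T02:41:06Z (HOME/STATUS.md l.127 «CLEARED … lens-4 g2
TopExponentSplit (g2/TopExponentSplit.lean@8cf38139 …)»; CRITIC-LEDGER row lens-4 g2; gen-0
FriabilityDial OBJECTION 01:11:05Z upheld and WITHDRAWN by the lens). Letter D: C is reserved for
lens-2 FreyLevelDivergence (CLEARED 01:57:34Z, birth held for its v3 retype), births proceed without
waiting. abc is NOT proved by anything here — every piece is open and strictly WEAKER than S (S ⟹
piece in the kernel), the conjunction of the pieces gives S by `closes`.

RANKED CRUXES. #2 BoundedExponentABC (crux) — H — for every k and every ε > 0 there is K = K(k, ε) >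
0 such that every abc triple with max_p ν_p(abc) ≤ k (all members (k+1)-free) satisfies c <
K·rad(abc)^{1+ε}. WEAKER: abc ⟹ it (kernel); rungs k ≤ 2 PROVED (`boundedExponent_le_two`, K = 2,
exponent 1); free floor c < 2·rad^{k/2} on every cell; first open cell k = 3 with the intermediate
target FourFreeBelowThreeHalves and its kernel reduction to UniformBinomialCubicThue. The attacked
conjunct. [piece H (generic side, attacked conjunct) · tag WEAKER (evidence: S ⟹ H kernel
`boundedExponent_of_abc`, lens file TopExponentSplit.lean sha256 8cf38139bb7e7a8a…; H ⟹ S: UNDECIDED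
residue with stated test «a quality-preserving exponent-LOWERING transfer into a fixed cell» — none
known; accepted WEAKER-by-structure: cells ε-free (T1 ok), no congruence superset (T5 n/a), vF/T_j
images EXIT bounded cells (e′ ≥ j·e) ⇒ no identity costume); critic verdict: CLEARED
decomp-abc-crit-1-g0 2026-08-30T02:41:06Z · NEC (node_iff) · leaves RUNGS DECIDED k ≤ 2 (c < √2·R,
`boundedExponent_le_two`; free floor c < 2R^{k/2}) + ATTACKABLE first open cell k = 3 (aside
FourFreeBelowThreeHalves, KERNEL reduction ⟸ aside UniformBinomialCubicThue = Thue–Siegel class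
OUTSIDE Literature.Barriers.ABC.BakerMethodBounds; fixed-(u,v) fibres PRINT) + INSTRUMENTABLE (cells
hold 84.6/92.9/96.6 % of 1,368,093 triples c ≤ 3000; max q on {e ≤ 3/4/5} = 1.2555/1.2920/1.4557;
all 241 q > 1.4 hits have e ≥ 5)] [difficulty: open-problem] (why it might fail: cannot fail unless
abc fails (kernel `boundedExponent_of_abc`); as a TARGET it is summit-hard at some k₀ iff a
quality-preserving exponent-LOWERING transfer into {e ≤ k₀} exists — none known
(powering/twists/Belyi maps multiply exponents); max q on {e≤3,4,5} = 1.2555/1.2920/1.4557.)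
[BombieriGubler2006, Langevin1993, Bennett2001, BakerStewart1988, Granville1998,
BrowkinBrzezinski1994]
#3 ExponentForgivenABC (crux) — F — there is m such that for every δ > 0 some K = K(δ) > 0 gives c <
K·c^{m/e(T)}·rad(abc)^{1+δ} for EVERY abc triple, e(T) = max_p ν_p(abc). WEAKER: abc ⟹ it (kernel,
any m); RUNG PROVED `topExponentSubexp_holds` (granting the two Pasten facts: log c ≤
c^{1/e(T)}·exp(13√(log R·log log R)) for R ≥ R₀); honest floor PrimePowerTopABC (abc for c = p^n)
implied; IDEA-NEEDED leaf TopExponentQuasiPoly; the structured side — de facto the residual if the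
tribunal reads its lift as inside BakerMethodBounds. [piece F (structured side) · tag WEAKER
(evidence: S ⟹ F kernel `exponentForgiven_of_abc`; F ⟹ S unknown; not costume by identities —
critic's pull-back check: relative forgiveness m/e INVARIANT under powering; F free on {e ≤ m},
near-abc on the high-e population (241/241 q > 1.4 hits have e ≥ 5, median 18)); critic verdict:
CLEARED decomp-abc-crit-1-g0 2026-08-30T02:41:06Z · NEC · leaves RUNG PROVED mod named facts (aside
TopExponentSubexp: log c ≤ c^{1/e}·exp(13√(log R·log log R)) from EG 4.2.1 + Pasten 2.5 —
PRINT-derived, numerically inactive, honest) + IDEA-NEEDED leaf (aside TopExponentQuasiPoly =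
BARRIER Literature.Barriers.ABC.BakerMethodBounds INSIDE, declared; residual if the tribunal so
reads — not declared) + honest floor (aside PrimePowerTopABC ⟸ F kernel, open) + INSTRUMENTABLE
(227/241 HQ have c^{1/e} ≤ log c)] [difficulty: open-problem] (why it might fail: cannot fail unless
abc fails (kernel `exponentForgiven_of_abc`); as a TARGET the upgrade exp(κ√(log R log log R)) ↦
K_δ·R^δ of the proved rung sits inside BakerMethodBounds unless the cushion c^{m/e(T)} is genuinely
used; m = 1 may already be abc-hard on Reyssat-type families with e bounded.) [Pasten2024,
StewartYu2001, StewartTijdeman1986, LagariasSoundararajan2011]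
#9 FourFreeBelowThreeHalves (support) — FIRST OPEN CELL of H, intermediate target: some θ < 3/2 and
K > 0 with c < K·rad(abc)^θ for every abc triple with e(T) ≤ 3 (all members 4-free). Free: θ = 3/2
(`fourFree_threeHalves`); abc gives every θ > 1; BoundedExponentABC ⟹ it
(`fourFreeBelowThreeHalves_of_bounded`); REDUCTION PROVED: UniformBinomialCubicThue ⟹ it
(`fourFreeBelowThreeHalves_of_uniformCubicThue`). ASIDE (outside the cone of `closes`; bc6 ruling
2026-08-30) until a split imports it. [difficulty: L] [Bennett2001, BakerStewart1988,
BombieriGubler2006, Danilov1982]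
#9 UniformBinomialCubicThue (support) — LEAF of H's first cell (Langevin–abc for binomial cubic
forms): some λ < 3, A ≥ 0, κ > 0 with κ·max(y,z)^{3−λ} ≤ (uv)^A·(u z³ − v y³) whenever u z³ > v y³ >
0 are coprime positive integers. Every fixed-(u,v) fibre is Thue–Siegel–Roth (ineffective) and
Baker–Stewart (effective λ(u,v) < 3, unit-dependent constant); uniformity with polynomial loss in uv
is the open point; abc gives λ = 13/5, A = 1 (`uniformBinomialCubicThue_of_abc`). ASIDE. [critic n1
for provers: the corner z = 1, v = 1, u = y³+1 (u − y³ = 1, coprime) forces A ≥ 1 − λ/3 > 0 — A = 0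
is FALSE; the typed ∃ A ≥ 0 is fine] [difficulty: XL] [Bennett2001, BakerStewart1988, Bugeaud2004,
BombieriGubler2006, EvertseGyory2015]
#9 TopExponentSubexp (support) — RUNG of F, PROVED in the draft (`topExponentSubexp_holds`):
granting Evertse–Győry Thm 4.2.1 over ℚ and Pasten's Thm 2.5 (tree facts), there are κ > 0 and R₀
with log c ≤ c^{1/e(T)}·exp(κ√(log R·log log R)) for every abc triple with R = rad(abc) ≥ R₀ (κ =
13, R₀ = exp L⋆ work). ASIDE (banked certificate; a prover may land it in Theorems verbatim).
[difficulty: provable-now] [Pasten2024, StewartYu2001]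
#9 TopExponentQuasiPoly (support) — IDEA-NEEDED leaf of F: some A > 0, B > 0 with log c ≤
A·c^{1/e(T)}·(log rad(abc))^B for every abc triple (abc gives B = 1, `topExponentQuasiPoly_of_abc`;
the proved rung gives exp(κ√(log R log log R)) in place of (log R)^B). Inside BakerMethodBounds
unless the cushion c^{1/e(T)} is used. ASIDE. [difficulty: open-problem] [Pasten2024, StewartYu2001,
StewartTijdeman1986]
#9 PrimePowerTopABC (support) — HONEST FLOOR of F: abc for prime-power c — for every prime p and ε >
0 some K > 0 with p^n < K·rad(a·b·p^n)^{1+ε} for every abc triple (a, b, p^n). Implied by F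
(`primePowerTop_of_exponentForgiven`: e(T) ≥ n makes the cushion ≤ p^m) and by abc; open. ASIDE.
[difficulty: open-problem] [StewartYu2001, LagariasSoundararajan2011, BrowkinBrzezinski1994]

TWO-LAYER PLAN. H ⇐ (its cells): BoundedExponentABC ⟺ ∀ m, HeavyCells (c^{m/e}) (kernel
`boundedExponent_iff_heavy`); the foreseen split once the first
cell moves is H ⇐ FourFreeABC (abc on {e ≤ 3}) → HigherCellsABC (abc on {4 ≤ e ≤ k}, all k) → H,
with FourFreeABC itself laddered
θ = 3/2 (free) → θ < 3/2 (FourFreeBelowThreeHalves ⇐ UniformBinomialCubicThue, reduction proved) → θ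
= 1 + ε. F ⇐ TopExponentQuasiPoly-type
leaves: F ⟸ «log c ≤ A c^{m'/e}(log R)^B for some m'» is NOT yet an implication (a power of log R is
not R^δ-uniform in K... it is: (log R)^B ≤
K_δ R^δ) — indeed TopExponentQuasiPoly with cushion c^{1/e} ⟹ F with any m ≥ 2 on the triples where
c^{1/e}·(log R)^B ≤ c^{m/e}, i.e. a
glued split F ⇐ TopExponentQuasiPoly → (F on the cell log R > c^{1/(eB)}) → F, foreseen, not filed.

KILL CRITERIA. Neither crux is refutable without refuting abc (both are kernel consequences of ABC,
`boundedExponent_of_abc` / `exponentForgiven_of_abc`).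
The route is retired `superseded` if a route proves abc on a class containing every bounded-exponent
cell (then H is moot) or if an
exponent-lowering quality-preserving transfer into a fixed cell {e ≤ k₀} is exhibited (then H at k₀
≡ abc and the node is a WALL: pivot to
the place-refined weight c^{m/e_S(T)} with e_S the top exponent outside a finite set S, or close).
The aside FourFreeBelowThreeHalves is
refuted by an infinite family of 4-free abc triples with log c/log rad → 3/2 (none known; max
1.2555); UniformBinomialCubicThue by a family
u_n z_n³ − v_n y_n³ = N_n with N_n (u_n v_n)^A < max(y_n,z_n)^{o(1)} for every A (would contradict
abc as well).

NOT DECOMPOSED YET. The interior of H beyond k = 3 (cells k = 4, 5, … each need their own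
Diophantine-approximation leaf: binomial quartic/quintic Thue
inequalities), the m-dependence of F, the effective constants of the Thue leaf (λ, A, κ), the
place-refined variants (e_S), and the
landing of the proved rungs (`boundedExponent_le_two`, `topExponentSubexp_holds`, the reduction
theorem) as Theorems files — layer 2,
after birth. No definition is requested: e(T) is inlined.

CHEAPEST FALSIFIER. Is the 4-free cell really low-quality, and is its extremal structure
binomial-cubic? Census run locally over the census instrument's
certified tables (data/topexp-census.txt sha256 dab267b2…9e0b; data/fourfree-profile.txt sha256
968ed351…85fa; scripts alongside):
among 20 185 known abc hits the cell {e ≤ 3} holds 67 (0.3 %), max q = 1.2555 at 1 + 12167 = 12168 =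
1521·2³ vs 23³; {e ≤ 4}: 381, max
1.2920 (1+80=81); {e ≤ 5}: 953, max 1.4557 (1+2400=2401); all 241 triples with q > 1.4 have e ≥ 5
(median 18). Of the 67 four-free hits
9 are Thue-type (a < c^{0.3} and cube-free cores uv < c^{0.3}: 467³ − 6·257³ = 5, 87³ − 13·37³ = 14,
…) and at every one the leaf
inequality with A = 1, κ = 1 holds for all 3 − λ ≤ 0.553 (abc predicts 3 − λ = 2/5). Exhaustive c ≤
3000: the cells e ≤ 3/4/5 hold
84.6 / 92.9 / 96.6 % of all 1 368 093 coprime triples. A 4-free family with q → 3/2, or a Thue-type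
family with (log a + log uv)/log max(y,z)
→ 0, kills the first cell's programme (and abc).

NUMBERS. Free floor: c < 2·rad^{k/2} on {e ≤ k} (kernel `cell_floor`); k ≤ 2: c < 2·rad (kernel).
abc ⟹ UniformBinomialCubicThue with λ = 13/5,
A = 1, κ = (C_{1/4}^{4/5})⁻¹ (kernel). Reduction constants: given (τ = 3 − λ ≤ 1, A, κ): η =
τ/(6(A+2)), θ = 3/(2 + η/2) < 3/2,
K = 3 + (1/κ)^{1/γ}, γ = τ(1−η)/3 − (A+1)η (kernel `fourFree_core`). F-rung: κ = 13, threshold R ≥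
exp L⋆(pastenK, κ₁) from the tree's
Pasten facts; Stewart–Yu 2001: log c ≤ C·R^{1/3}(log R)³ (StewartYu2001); Baker–Stewart: |∛a − p/q|
> c(a)·q^{−κ(a)}, κ(a) < 3,
c(a) ≈ (40a)⁶·ε_a with ε_a the fundamental unit of ℚ(∛a) (BakerStewart1988 Thm 1); Bennett 2001:
|axⁿ − byⁿ| = 1 has at most one
solution in positive integers for n ≥ 3 (Bennett2001).

DEFINITION REQUESTS. None: e(T) is inlined as `(a*b*c).primeFactors.sup fun p =>
(a*b*c).factorization p` (= `topExp (a*b*c)` of the draft, rfl);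
`IsABCTriple`, `rad`, the Pasten / Evertse–Győry facts exist in Literature.

Novelty: Searches (2026-08-30): lit search --hybrid "abc conjecture restricted to triples with bounded prime
exponents power-free abc triples" -n 6 (textbook pages only: EvertseGyory2015 pp 87–89,
BombieriGubler2006 ch. 12, Guy B19 — no bounded-exponent formulation); lit search "cube-free abc
triples quality" (1 irrelevant local, 6 crossref preprints, none on exponent cells); lit galaxy
search "power-free abc|cube-free abc|powerfree abc|bounded exponents abc" --star all (0 rows in
panama/pdf/crabby); lit galaxy search "Thue-Siegel principle|binomial Thue|axn-byn" --star all (16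
rows: [galaxy:pdf:1347443140] Bombieri–van der Poorten–Vaaler 1996 ASNSP cubic effective measures,
[galaxy:pdf:8901954482175398600] Alladustov thesis on Thue solution counts,
[galaxy:panama:503782483951685] Evertse–Győry); lit search --hybrid "Thue inequality binomial form
ax^n - by^n …" ([corpus:book:evertse2015 pp 290, 310], [corpus:book:bombieri2006 pp 148–150],
[corpus:book:bugeaud2004 p 58 Thm 2.4, p 59]); lit read book:bombieri2006 --pages 395-440 --grep
Roth ([corpus:book:bombieri2006 p398 Thm 12.2.9 abc ⟹ Roth, p400–401 Thm 12.2.12 Langevin: F =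
xy(x+y) recovers abc, p401 Thm 12.2.15 Granville power-free values]); lit read book:baker1988
--pages 1-9 ([corpus:book:baker1988-new-advances-transcendence-theory p8 Thm 1, p9 Thm 2]
Baker–Stewart); lit search "Bennett rational approximation algebraic numbers small height"
([corpus:paper:doi-10-1515-crll-2001-044]); rg over lean/Summits/ABC (RootDecompA, CheapP  [refs: book:evertse2015, book:bombieri2006, book:bugeaud2004, book:baker1988, book:baker1988-new-advances-transcendence-theory, paper:doi-10-1515-crll-2001-044, EvertseGyory2015, BombieriGubler2006, Langevin1993, Granville1998]

Barriers (technique_class: exponent-cells, forgiving-split, thue-siegel, baker): - technique_class: exponent-cells, forgiving-split, thue-siegel, baker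
- Literature.Barriers.ABC.BakerMethodBounds: F's rung TopExponentSubexp is INSIDE (it is the
barrier's own method, Pasten's subexponential bound, with the extra cushion c^{1/e(T)}); lifting it
to TopExponentQuasiPoly / to F head-on would require beating Stewart–Yu–Pasten — it does not evade;
the bet is that the cushion c^{m/e(T)}, absent from every Baker-type statement, lets the p₀·B^{13}
term be traded against e(T) (p₀ ≤ c^{1/e(T)}) rather than improved, and F is declared the residual
side if the tribunal reads it otherwise. H and its leaves are OUTSIDE: no bound of c by linear forms
in logarithms is asked on a bounded-exponent cell; the first cell goes through Thue–Siegel /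
hypergeometric approximation (Bennett2001, BakerStewart1988), a different technique class.
- Literature.Barriers.ABC.EpsilonCannotBeDropped: not touched — H keeps 1+ε per cell,
FourFreeBelowThreeHalves asks θ < 3/2 not θ = 1; the Granville–Tucker / Stewart–Tijdeman families
use p² | b with unbounded powers of small primes (e → ∞) and leave every cell.
- Literature.Barriers.ABC.HallExponentSharp: not touched — Danilov–Hall families x³ − y² = k live in
low cells with q → 1 < 3/2; no Hall-type exponent is claimed.
- Literature.Barriers.ABC.ExplicitABCQualityFloor: not touched — no explicit constant; Reyssat's
triple (2, 3¹⁰·109, 23⁵) has e = 10 and sits in the cells k ≥ 10 harmlessly (H is implied by abc).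
- Literature.Barriers.ABC.Tijde

History (route lifecycle, newest last):
- 2026-08-30T05:10:37Z · rev 4: dropped GiantTopHalf, DispersedForgivenHalf, ExponentForgivenABCGlue — lens-4 g5 AUDIT NODE ShareTransport, recipe R1 (critic CLEARED decomp-abc-crit-1-g0 2026-08-30T05:09:51Z, STATUS l.303; the critic's gen-4 clearance l.212 REVER (planner-decomp-abc-writer-1-g2-0)
- 2026-08-30T21:38:41Z · RESIDUAL declared: ExponentForgivenABC (stmt-ABC-25610) — summit-strength until shown otherwise: gate10 D-0170 bookkeeping: tribunal residual of record payload.tribunal.residual [stmt-ABC-25610]; statement untouched; (planner-decomp-abc-writer-1-g23-0)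

sub-problem: ABC · status: open · opened planner-decomp-abc-writer-1-g0-0 2026-08-30T02:44:19Z · rev 5 · ledger route-ABC-RootDecompD
GENERATED by the gate from the ledger (D-0016/17). Provers cite these decls: `theorem foo : Summit.ABC.ABC.Theses.RootDecompD.<Decl> := …` in Summits/ABC/ABC/Theorems/<Name>.lean.
-/

namespace Summit.ABC.ABC.Theses.RootDecompD

open scoped BigOperators Topology Manifold Classical MeasureTheory ProbabilityTheory Matrix InnerProductSpace ComplexConjugate ContinuousMap
open Filter Set Function TopologicalSpace MeasureTheory

attribute [summit_statement] _root_.ABC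

open Literature.Abc

/-- item stmt-ABC-25609 · crux · leaf IDEA-NEEDED · rank 2 · open · by planner
why it might fail: cannot fail unless abc fails (kernel `boundedExponent_of_abc`); as a TARGET it is summit-hard at some k₀ iff a quality-preserving exponent-LOWERING transfer into {e ≤ k₀} exists — none known (powering/twists/Belyi maps multiply exponents); max q on {e≤3,4,5} = 1.2555/1.2920/1.4557.
sources: BombieriGubler2006, Langevin1993, Bennett2001, BakerStewart1988, Granville1998, BrowkinBrzezinski1994
[crux] H — for every k and every ε > 0 there is K = K(k, ε) > 0 such that every abc triple with
max_p ν_p(abc) ≤ k (all members (k+1)-free) satisfies c < K·rad(abc)^{1+ε}. WEAKER: abc ⟹ it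
(kernel); rungs k ≤ 2 PROVED (`boundedExponent_le_two`, K = 2, exponent 1); free floor c <
2·rad^{k/2} on every cell; first open cell k = 3 with the intermediate target
FourFreeBelowThreeHalves and its kernel reduction to UniformBinomialCubicThue. The attacked
conjunct. [piece H (generic side, attacked conjunct) · tag WEAKER (evidence: S ⟹ H kernel
`boundedExponent_of_abc`, lens file TopExponentSplit.lean sha256 8cf38139bb7e7a8a…; H ⟹ S: UNDECIDED
residue with stated test «a quality-preserving exponent-LOWERING transfer into a fixed cell» — none
known; accepted WEAKER-by-structure: cells ε-free (T1 ok), no congruence superset (T5 n/a), vF/T_j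
images EXIT bounded cells (e′ ≥ j·e) ⇒ no identity costume); critic verdict: CLEARED
decomp-abc-crit-1-g0 2026-08-30T02:41:06Z · NEC (node_iff) · leaves RUNGS DECIDED k ≤ 2 (c < √2·R,
`boundedExponent_le_two`; free floor c < 2R^{k/2}) + ATTACKABLE first open cell k = 3 (aside
FourFreeBelowThreeHalves, KERNEL reduction ⟸ aside UniformBinomialCubicThue = Thue– -/
@[route_item "route-ABC-RootDecompD", crux (bottleneck := idea) (source := "ledger D-0171 leaf tag IDEA-NEEDED on stmt-ABC-25609, 2026-09-01")]
def BoundedExponentABC : Prop :=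
  ∀ k : ℕ, ∀ ε : ℝ, 0 < ε → ∃ K : ℝ, 0 < K ∧ ∀ a b c : ℕ, Literature.NumberTheory.DiophantineGeometry.IsABCTriple a b c → ((a * b * c).primeFactors.sup fun p => (a * b * c).factorization p) ≤ k → (c : ℝ) < K * ((Literature.NumberTheory.DiophantineGeometry.rad a b c : ℕ) : ℝ) ^ (1 + ε)

/-- item stmt-ABC-25610 · crux · RESIDUAL (gen 0; summit-strength until shown otherwise, D-0170) · leaf IDEA-NEEDED · rank 3 · SPLIT (gen 1) into GiantTopHalf, DispersedForgivenHalf + glue ExponentForgivenABCGlue · direct attempts still welcome (low priority) · by planner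
why it might fail: cannot fail unless abc fails (kernel `exponentForgiven_of_abc`); as a TARGET the upgrade exp(κ√(log R log log R)) ↦ K_δ·R^δ of the proved rung sits inside BakerMethodBounds unless the cushion c^{m/e(T)} is genuinely used; m = 1 may already be abc-hard on Reyssat-type families with e bounded.
sources: Pasten2024, StewartYu2001, StewartTijdeman1986, LagariasSoundararajan2011
[crux] F — there is m such that for every δ > 0 some K = K(δ) > 0 gives c <
K·c^{m/e(T)}·rad(abc)^{1+δ} for EVERY abc triple, e(T) = max_p ν_p(abc). WEAKER: abc ⟹ it (kernel,
any m); RUNG PROVED `topExponentSubexp_holds` (granting the two Pasten facts: log c ≤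
c^{1/e(T)}·exp(13√(log R·log log R)) for R ≥ R₀); honest floor PrimePowerTopABC (abc for c = p^n)
implied; IDEA-NEEDED leaf TopExponentQuasiPoly; the structured side — de facto the residual if the
tribunal reads its lift as inside BakerMethodBounds. [piece F (structured side) · tag WEAKER
(evidence: S ⟹ F kernel `exponentForgiven_of_abc`; F ⟹ S unknown; not costume by identities —
critic's pull-back check: relative forgiveness m/e INVARIANT under powering; F free on {e ≤ m},
near-abc on the high-e population (241/241 q > 1.4 hits have e ≥ 5, median 18)); critic verdict:
CLEARED decomp-abc-crit-1-g0 2026-08-30T02:41:06Z · NEC · leaves RUNG PROVED mod named facts (aside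
TopExponentSubexp: log c ≤ c^{1/e}·exp(13√(log R·log log R)) from EG 4.2.1 + Pasten 2.5 —
PRINT-derived, numerically inactive, honest) + IDEA-NEEDED leaf (aside TopExponentQuasiPoly =
BARRIER Literature.Barriers.ABC.BakerMethodBounds INSIDE, declared; residual i -/
@[route_item "route-ABC-RootDecompD", crux (bottleneck := idea) (source := "ledger wanted_by.residual on stmt-ABC-25610, 2026-09-01")]
def ExponentForgivenABC : Prop :=
  ∃ m : ℕ, ∀ δ : ℝ, 0 < δ → ∃ K : ℝ, 0 < K ∧ ∀ a b c : ℕ, Literature.NumberTheory.DiophantineGeometry.IsABCTriple a b c → (c : ℝ) < K * (c : ℝ) ^ ((m : ℝ) / ((((a * b * c).primeFactors.sup fun p => (a * b * c).factorization p : ℕ) : ℝ))) * ((Literature.NumberTheory.DiophantineGeometry.rad a b c : ℕ) : ℝ) ^ (1 + δ)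

/-- item stmt-ABC-25611 · aside · rank 9 · open · by planner
sources: Bennett2001, BakerStewart1988, BombieriGubler2006, Danilov1982
[aside] FIRST OPEN CELL of H, intermediate target: some θ < 3/2 and K > 0 with c < K·rad(abc)^θ for
every abc triple with e(T) ≤ 3 (all members 4-free). Free: θ = 3/2 (`fourFree_threeHalves`); abc
gives every θ > 1; BoundedExponentABC ⟹ it (`fourFreeBelowThreeHalves_of_bounded`); REDUCTION
PROVED: UniformBinomialCubicThue ⟹ it (`fourFreeBelowThreeHalves_of_uniformCubicThue`). ASIDE
(outside the cone of `closes`; bc6 ruling 2026-08-30) until a split imports it. [difficulty: L] -/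
@[route_item "route-ABC-RootDecompD"]
def FourFreeBelowThreeHalves : Prop :=
  ∃ θ : ℝ, θ < 3 / 2 ∧ ∃ K : ℝ, 0 < K ∧ ∀ a b c : ℕ, Literature.NumberTheory.DiophantineGeometry.IsABCTriple a b c → ((a * b * c).primeFactors.sup fun p => (a * b * c).factorization p) ≤ 3 → (c : ℝ) < K * ((Literature.NumberTheory.DiophantineGeometry.rad a b c : ℕ) : ℝ) ^ θ

/-- item stmt-ABC-25612 · aside · rank 9 · open · by planner
sources: Bennett2001, BakerStewart1988, Bugeaud2004, BombieriGubler2006, EvertseGyory2015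
[aside] LEAF of H's first cell (Langevin–abc for binomial cubic forms): some λ < 3, A ≥ 0, κ > 0
with κ·max(y,z)^{3−λ} ≤ (uv)^A·(u z³ − v y³) whenever u z³ > v y³ > 0 are coprime positive integers.
Every fixed-(u,v) fibre is Thue–Siegel–Roth (ineffective) and Baker–Stewart (effective λ(u,v) < 3,
unit-dependent constant); uniformity with polynomial loss in uv is the open point; abc gives λ =
13/5, A = 1 (`uniformBinomialCubicThue_of_abc`). ASIDE. [critic n1 for provers: the corner z = 1, v
= 1, u = y³+1 (u − y³ = 1, coprime) forces A ≥ 1 − λ/3 > 0 — A = 0 is FALSE; the typed ∃ A ≥ 0 is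
fine] [difficulty: XL] -/
@[route_item "route-ABC-RootDecompD"]
def UniformBinomialCubicThue : Prop :=
  ∃ lam : ℝ, lam < 3 ∧ ∃ A : ℝ, 0 ≤ A ∧ ∃ κ : ℝ, 0 < κ ∧ ∀ u v y z : ℕ, 0 < u → 0 < v → 0 < y → 0 < z → v * y ^ 3 < u * z ^ 3 → Nat.Coprime (u * z ^ 3) (v * y ^ 3) → κ * ((max y z : ℕ) : ℝ) ^ (3 - lam) ≤ ((u * v : ℕ) : ℝ) ^ A * ((u * z ^ 3 - v * y ^ 3 : ℕ) : ℝ)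

/-- item stmt-ABC-25613 · aside · rank 9 · open · by planner
sources: Pasten2024, StewartYu2001
[aside] RUNG of F, PROVED in the draft (`topExponentSubexp_holds`): granting Evertse–Győry Thm 4.2.1
over ℚ and Pasten's Thm 2.5 (tree facts), there are κ > 0 and R₀ with log c ≤ c^{1/e(T)}·exp(κ√(log
R·log log R)) for every abc triple with R = rad(abc) ≥ R₀ (κ = 13, R₀ = exp L⋆ work). ASIDE (banked
certificate; a prover may land it in Theorems verbatim). [difficulty: provable-now] [writer: typed
UNCONDITIONAL for staffability (D-0027 §2.1) — the lens statement carried the cite-only print facts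
Literature.NumberTheory.DiophantineGeometry.Dioph.evertseGyory_thm_4_2_1_rat,
Literature.NumberTheory.DiophantineGeometry.pasten2024_thm_2_5 as antecedents; the conditional
kernel proof lands under Theorems/ with those facts as hypotheses via --supports; this item closes
once they carry _holds] -/
@[route_item "route-ABC-RootDecompD"]
def TopExponentSubexp : Prop :=
  ∃ κ : ℝ, 0 < κ ∧ ∃ R₀ : ℝ, ∀ a b c : ℕ, Literature.NumberTheory.DiophantineGeometry.IsABCTriple a b c → R₀ ≤ ((Literature.NumberTheory.DiophantineGeometry.rad a b c : ℕ) : ℝ) → Real.log c ≤ (c : ℝ) ^ (1 / ((((a * b * c).primeFactors.sup fun p => (a * b * c).factorization p : ℕ) : ℝ))) * Real.exp (κ * Real.sqrt (Real.log ((Literature.NumberTheory.DiophantineGeometry.rad a b c : ℕ) : ℝ) * Real.log (Real.log ((Literature.NumberTheory.DiophantineGeometry.rad a b c : ℕ) : ℝ))))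

/-- item stmt-ABC-25614 · aside · rank 9 · open · by planner
sources: Pasten2024, StewartYu2001, StewartTijdeman1986
[aside] IDEA-NEEDED leaf of F: some A > 0, B > 0 with log c ≤ A·c^{1/e(T)}·(log rad(abc))^B for
every abc triple (abc gives B = 1, `topExponentQuasiPoly_of_abc`; the proved rung gives exp(κ√(log R
log log R)) in place of (log R)^B). Inside BakerMethodBounds unless the cushion c^{1/e(T)} is used.
ASIDE. [difficulty: open-problem] -/
@[route_item "route-ABC-RootDecompD"]
def TopExponentQuasiPoly : Prop :=
  ∃ A : ℝ, 0 < A ∧ ∃ B : ℝ, 0 < B ∧ ∀ a b c : ℕ, Literature.NumberTheory.DiophantineGeometry.IsABCTriple a b c → Real.log c ≤ A * (c : ℝ) ^ (1 / ((((a * b * c).primeFactors.sup fun p => (a * b * c).factorization p : ℕ) : ℝ))) * Real.log ((Literature.NumberTheory.DiophantineGeometry.rad a b c : ℕ) : ℝ) ^ B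

/-- item stmt-ABC-25615 · aside · rank 9 · open · by planner
sources: StewartYu2001, LagariasSoundararajan2011, BrowkinBrzezinski1994
[aside] HONEST FLOOR of F: abc for prime-power c — for every prime p and ε > 0 some K > 0 with p^n <
K·rad(a·b·p^n)^{1+ε} for every abc triple (a, b, p^n). Implied by F
(`primePowerTop_of_exponentForgiven`: e(T) ≥ n makes the cushion ≤ p^m) and by abc; open. ASIDE.
[difficulty: open-problem] -/
@[route_item "route-ABC-RootDecompD"]
def PrimePowerTopABC : Prop :=
  ∀ p : ℕ, p.Prime → ∀ ε : ℝ, 0 < ε → ∃ K : ℝ, 0 < K ∧ ∀ a b n : ℕ, Literature.NumberTheory.DiophantineGeometry.IsABCTriple a b (p ^ n) → ((p ^ n : ℕ) : ℝ) < K * ((Literature.NumberTheory.DiophantineGeometry.rad a b (p ^ n) : ℕ) : ℝ) ^ (1 + ε)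

/-- item stmt-ABC-26134 · aside · rank 9 · open · by planner
[aside] RUNG of H's first open cell, PROVED in the gen-3 draft mod the tree fact `roth` (abc.S13,
discharged in the tree by `roth_holds`): for every θ > 9/7 and every coefficient pair u, v > 0 some
K = K(θ,u,v) > 0 with c < K·rad(abc)^θ for every abc triple with e(T) ≤ 3 (all members 4-free) of
the shape max(a,b) = v·y³, c = u·z³ (any y, z). Free floor on each family 3/2; Roth at exponent 2 +
1/r for ∛(v/u) plus the 4-free bookkeeping c^{7r−1} ≤ (2v)^{7r−1}N³u^{9r}·rad^{9r}
(`fourFreeBinomialFamilies_of_roth`, `fourFreeBoundedCores_of_roth` = one constant for all u, v ≤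
H₀). Offered as the T3/BC5 WITNESS OF WEAKNESS for BoundedExponentABC (a proved case of H below its
free floor where abc itself is open). ASIDE. [difficulty: provable-now] [lens-4 gen 3
TopExponentSplit v2 (NODE 2026-08-30T03:00:17Z, file sha256 14b76d30…); critic CLEARED
decomp-abc-crit-1-g0 2026-08-30T03:01:46Z (ENDORSE w1); kernel proof mod roth in
g3/witness/FourFreeBinomialFamiliesOfRoth.lean (sha256 6e7cc6a9…), provers land it with --supports
stmt-ABC-25609 and retarget by Iff.rfl; T3/BC5 witness of weakness for BoundedExponentABC] -/
@[route_item "route-ABC-RootDecompD"]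
def FourFreeBinomialFamilies : Prop :=
  ∀ θ : ℝ, 9 / 7 < θ → ∀ u v : ℕ, 0 < u → 0 < v → ∃ K : ℝ, 0 < K ∧ ∀ a b c y z : ℕ, Literature.NumberTheory.DiophantineGeometry.IsABCTriple a b c → ((a * b * c).primeFactors.sup fun p => (a * b * c).factorization p) ≤ 3 → max a b = v * y ^ 3 → c = u * z ^ 3 → (c : ℝ) < K * ((Literature.NumberTheory.DiophantineGeometry.rad a b c : ℕ) : ℝ) ^ θ

/-- item stmt-ABC-26855 · aside · rank 9 · open · by planner
[aside] [aside · CONTENT LOCATOR of GiantTopHalf · lens 4 generation 4] abc on the DOUBLE-GIANT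
locus: c AND the larger summand max(a,b) each carry at least half of their log₂-mass on one prime
(then {2,3} in some order: the two-tiny-primes S-unit / Pillai corner 3^M·t + r = 2^N·s, s < √c, t <
√max). Kernel: given DispersedForgivenHalf, GiantTopHalf ⟺ DoubleGiantTopHalf (φ₂₂ = (b², c(a−b),
a²) moves a dispersed larger summand into the top slot, cushion ≤ 4^{m/λ}, radical ≤
rad(abc)·(a−b)); so modulo the residual the giant child's content is exactly this locus. IDEA-NEEDED
(Baker with two fixed primes bounds |p^ν s − q^μ t| from below, not its radical); INSTRUMENTABLE
(population share 4.4·10⁻⁵ for c ≤ 3000; 767/432408 VKM triples). [aside/locator · IDEA-NEEDED ·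
kernel: modulo DispersedForgivenHalf, GiantTopHalf ⟺ DoubleGiantTopHalf (Pillai corner 3^M t + r =
2^N s: 5+27 = 32, 7³+3¹⁰ = 2¹¹·29 …; 4/241 HQ, 114 hits, infinitude OPEN — (c)-caveat for this aside
only); lens-4 g4 aside.json sha256 8a26a11b…; critic CLEARED 2026-08-30T03:43:09Z w2] -/
@[route_item "route-ABC-RootDecompD"]
def DoubleGiantTopHalf : Prop :=
  ∀ ε : ℝ, 0 < ε → ∃ K : ℝ, 0 < K ∧ ∀ a b c : ℕ, Literature.NumberTheory.DiophantineGeometry.IsABCTriple a b c → (c : ℝ) ^ (1 / 2 : ℝ) ≤ (2 : ℝ) ^ (c.primeFactors.sup fun p => c.factorization p) → ((max a b : ℕ) : ℝ) ^ (1 / 2 : ℝ) ≤ (2 : ℝ) ^ ((max a b).primeFactors.sup fun p => (max a b).factorization p) → (c : ℝ) < K * ((Literature.NumberTheory.DiophantineGeometry.rad a b c : ℕ) : ℝ) ^ (1 + ε)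

/-- item stmt-ABC-28357 · aside · rank 9 · open · by planner
why it might fail: only with abc on positive-top-share triples: an infinite family with a prime ≤ 2^{1/δ₀} carrying share ≥ δ₀ of c, quality ≥ 1+δ₀, that ALSO escapes every hidden-top tower (a+2b, 2a+b, a²+8bc giant) — by the p-adic Roth class contradiction such families are finite per δ: as safe as F.
sources: arXiv:2205.10153, StewartYu2001, BombieriGubler2006, Ridout1958
[aside · RECORD of the gen-5 audit · lens 4 generation 5] abc ON POSITIVE TOP SHARE, tolerance-tied:
for every δ>0, abc with exponent 1+δ on the triples with (c:ℝ)^δ ≤ 2^{e_c}, e_c = max_p ν_p(c).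
Kernel (HOME/decomp-abc-lens-4/g5/ShareTransport.lean): ⟸ F = ExponentForgivenABC 25610
(giantTopDial_of_exponentForgiven), ⟺ ∀λ>0 GiantTopABC λ (giantTopDial_iff_forall) hence ⟹
GiantTopHalf 26838; rung PROVED modulo the aside TopExponentSubexp 25613 (giantTopDial_rung); NOT a
load-bearing piece: the complementary residual DispersedForgivenDial decides it up to finitely many
triples per δ (hidden-top chain (A²,4BC,(A+2B)²) + the tree's proved Ridout.false_of_class_abs;
depth 1 in kernel hiddenDispersed_of_dispersedForgivenDial; census dial-census.txt: every known
c-giant hit above the satisfiability threshold exported at depth ≤ 2). Banked so that the share dial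
is on record and never re-proposed as a split; INSTRUMENTABLE (top-share distribution: census-1
instrument-g5 ANSWERS §A, L4L6g5_table_scan.json). [writer g2: recipe R2 of the lens-4 g5 audit,
critic CLEARED 2026-08-30T05:09:51Z «harmless as an ASIDE»; outside the cone of closes; bc6 aside] -/
@[route_item "route-ABC-RootDecompD"]
def GiantTopDial : Prop :=
  ∀ δ : ℝ, 0 < δ → ∃ K : ℝ, 0 < K ∧ ∀ a b c : ℕ, Literature.NumberTheory.DiophantineGeometry.IsABCTriple a b c → (c : ℝ) ^ δ ≤ (2 : ℝ) ^ (c.primeFactors.sup fun p => c.factorization p) → (c : ℝ) < K * ((Literature.NumberTheory.DiophantineGeometry.rad a b c : ℕ) : ℝ) ^ (1 + δ)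

/-- item stmt-ABC-25616 · assembly · rank 1 · open · by planner
sources: BombieriGubler2006
[assembly] ExponentForgivenABC → BoundedExponentABC → ABC -/
@[route_item "route-ABC-RootDecompD"]
def Assembly : Prop :=
  (∃ m : ℕ, ∀ δ : ℝ, 0 < δ → ∃ K : ℝ, 0 < K ∧ ∀ a b c : ℕ, Literature.NumberTheory.DiophantineGeometry.IsABCTriple a b c → (c : ℝ) < K * (c : ℝ) ^ ((m : ℝ) / ((((a * b * c).primeFactors.sup fun p => (a * b * c).factorization p : ℕ) : ℝ))) * ((Literature.NumberTheory.DiophantineGeometry.rad a b c : ℕ) : ℝ) ^ (1 + δ)) → (∀ k : ℕ, ∀ ε : ℝ, 0 < ε → ∃ K : ℝ, 0 < K ∧ ∀ a b c : ℕ, Literature.NumberTheory.DiophantineGeometry.IsABCTriple a b c → ((a * b * c).primeFactors.sup fun p => (a * b * c).factorization p) ≤ k → (c : ℝ) < K * ((Literature.NumberTheory.DiophantineGeometry.rad a b c : ℕ) : ℝ) ^ (1 + ε)) → _root_.ABC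

/-! D-0027 §2.1 — DECIDING THEOREM (planner-authored via `route open/edit --closes-file`; by planner-decomp-abc-writer-1-g0-0 2026-08-30T02:44:19Z):
its hypotheses are this route's items and its conclusion the sub-problem Statement (glue_lint), and it elaborates with this file. -/

@[closes "route-ABC-RootDecompD"] theorem closes (hF : ExponentForgivenABC) (hH : BoundedExponentABC) : _root_.ABC := by
  rw [_root_.ABC_iff]
  obtain ⟨m, hF⟩ := hF
  have one_le_rad : ∀ a b c : ℕ,
      (1 : ℝ) ≤ ((Literature.NumberTheory.DiophantineGeometry.rad a b c : ℕ) : ℝ) := by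
    intro a b c
    have h : Literature.NumberTheory.DiophantineGeometry.rad a b c ≠ 0 := by
      rw [Literature.NumberTheory.DiophantineGeometry.rad_def]
      exact UniqueFactorizationMonoid.radical_ne_zero
    exact_mod_cast Nat.one_le_iff_ne_zero.mpr h
  suffices main : ∀ ε : ℝ, 0 < ε → ε ≤ 1 → ∃ C : ℝ, 0 < C ∧ ∀ a b c : ℕ,
      Literature.NumberTheory.DiophantineGeometry.IsABCTriple a b c →
      (c : ℝ) < C * ((Literature.NumberTheory.DiophantineGeometry.rad a b c : ℕ) : ℝ) ^ (1 + ε) by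
    intro ε hε
    obtain ⟨C, hC, h⟩ := main (min ε 1) (lt_min hε one_pos) (min_le_right _ _)
    refine ⟨C, hC, fun a b c habc => (h a b c habc).trans_le ?_⟩
    exact mul_le_mul_of_nonneg_left
      (Real.rpow_le_rpow_of_exponent_le (one_le_rad a b c) (by linarith [min_le_left ε 1])) hC.le
  intro ε hε hε1
  -- H on the cell `e(T) ≤ ⌊m/(ε/3)⌋`, F at `δ = ε/3`
  obtain ⟨K₁, hK₁, h₁⟩ := hH ⌊(m : ℝ) / (ε / 3)⌋₊ (ε / 3) (by positivity)
  obtain ⟨K₂, hK₂, h₂⟩ := hF (ε / 3) (by positivity)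
  have hη1 : 0 < 1 - ε / 3 := by linarith
  have hexpo : (1 + ε / 3) * (1 - ε / 3)⁻¹ ≤ 1 + ε := by
    rw [← div_eq_mul_inv, div_le_iff₀ hη1]
    nlinarith
  refine ⟨max K₁ (K₂ ^ (1 - ε / 3)⁻¹), lt_max_of_lt_left hK₁, fun a b c habc => ?_⟩
  have hR := one_le_rad a b c
  have hR0 : (0 : ℝ) ≤ ((Literature.NumberTheory.DiophantineGeometry.rad a b c : ℕ) : ℝ) := by linarith
  have hc2 : 2 ≤ c := by
    obtain ⟨ha, hb, hab, -⟩ := habc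
    omega
  have hc0 : (0 : ℝ) < (c : ℝ) := by exact_mod_cast (show 0 < c by omega)
  have hc1 : (1 : ℝ) < (c : ℝ) := by exact_mod_cast (show 1 < c by omega)
  have hRε : ((Literature.NumberTheory.DiophantineGeometry.rad a b c : ℕ) : ℝ) ^ (1 + ε / 3) ≤
      ((Literature.NumberTheory.DiophantineGeometry.rad a b c : ℕ) : ℝ) ^ (1 + ε) :=
    Real.rpow_le_rpow_of_exponent_le hR (by linarith)
  have hRpos : (0 : ℝ) < ((Literature.NumberTheory.DiophantineGeometry.rad a b c : ℕ) : ℝ) ^ (1 + ε) :=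
    Real.rpow_pos_of_pos (by linarith) _
  set e : ℕ := (a * b * c).primeFactors.sup (fun p => (a * b * c).factorization p) with he
  by_cases hcell : (c : ℝ) ^ (ε / 3) ≤ (c : ℝ) ^ ((m : ℝ) / (e : ℝ))
  · -- heavy case: `ε/3 ≤ m/e`, so `e ≤ ⌊m/(ε/3)⌋` and H applies
    have hexp : ε / 3 ≤ (m : ℝ) / (e : ℝ) := by
      rwa [Real.rpow_le_rpow_left_iff hc1] at hcell
    have hek : e ≤ ⌊(m : ℝ) / (ε / 3)⌋₊ := by
      by_cases he0 : e = 0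
      · rw [he0]; exact Nat.zero_le _
      · have hepos : (0 : ℝ) < (e : ℝ) := by exact_mod_cast Nat.pos_of_ne_zero he0
        apply Nat.le_floor
        rw [le_div_iff₀ (by positivity : (0 : ℝ) < ε / 3)]
        have := (le_div_iff₀ hepos).mp hexp
        linarith
    calc (c : ℝ) < K₁ * ((Literature.NumberTheory.DiophantineGeometry.rad a b c : ℕ) : ℝ) ^ (1 + ε / 3) :=
          h₁ a b c habc hek
      _ ≤ K₁ * ((Literature.NumberTheory.DiophantineGeometry.rad a b c : ℕ) : ℝ) ^ (1 + ε) :=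
          mul_le_mul_of_nonneg_left hRε hK₁.le
      _ ≤ max K₁ (K₂ ^ (1 - ε / 3)⁻¹) *
            ((Literature.NumberTheory.DiophantineGeometry.rad a b c : ℕ) : ℝ) ^ (1 + ε) :=
          mul_le_mul_of_nonneg_right (le_max_left _ _) hRpos.le
  · -- light case: the forgiven weight is `< c^{ε/3}`
    push Not at hcell
    have hcη : 0 < (c : ℝ) ^ (ε / 3) := Real.rpow_pos_of_pos hc0 _
    have hR3 : 0 < ((Literature.NumberTheory.DiophantineGeometry.rad a b c : ℕ) : ℝ) ^ (1 + ε / 3) :=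
      Real.rpow_pos_of_pos (by linarith) _
    have hlt : (c : ℝ) < K₂ * (c : ℝ) ^ (ε / 3) *
        ((Literature.NumberTheory.DiophantineGeometry.rad a b c : ℕ) : ℝ) ^ (1 + ε / 3) := by
      calc (c : ℝ) < K₂ * (c : ℝ) ^ ((m : ℝ) / (e : ℝ)) *
            ((Literature.NumberTheory.DiophantineGeometry.rad a b c : ℕ) : ℝ) ^ (1 + ε / 3) := h₂ a b c habc
        _ ≤ K₂ * (c : ℝ) ^ (ε / 3) *
            ((Literature.NumberTheory.DiophantineGeometry.rad a b c : ℕ) : ℝ) ^ (1 + ε / 3) := by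
            gcongr
    have hpow : (c : ℝ) ^ (1 - ε / 3) <
        K₂ * ((Literature.NumberTheory.DiophantineGeometry.rad a b c : ℕ) : ℝ) ^ (1 + ε / 3) := by
      rw [Real.rpow_sub hc0, Real.rpow_one, div_lt_iff₀ hcη]
      calc (c : ℝ) < K₂ * (c : ℝ) ^ (ε / 3) *
            ((Literature.NumberTheory.DiophantineGeometry.rad a b c : ℕ) : ℝ) ^ (1 + ε / 3) := hlt
        _ = K₂ * ((Literature.NumberTheory.DiophantineGeometry.rad a b c : ℕ) : ℝ) ^ (1 + ε / 3) *
            (c : ℝ) ^ (ε / 3) := by ring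
    have hinv : 0 < (1 - ε / 3)⁻¹ := inv_pos.mpr hη1
    have hc1η : 0 ≤ (c : ℝ) ^ (1 - ε / 3) := (Real.rpow_pos_of_pos hc0 _).le
    have hroot : (c : ℝ) = ((c : ℝ) ^ (1 - ε / 3)) ^ (1 - ε / 3)⁻¹ :=
      (Real.rpow_rpow_inv hc0.le hη1.ne').symm
    have hstep : ((c : ℝ) ^ (1 - ε / 3)) ^ (1 - ε / 3)⁻¹ <
        (K₂ * ((Literature.NumberTheory.DiophantineGeometry.rad a b c : ℕ) : ℝ) ^ (1 + ε / 3)) ^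
          (1 - ε / 3)⁻¹ :=
      Real.rpow_lt_rpow hc1η hpow hinv
    have hsplit : (K₂ * ((Literature.NumberTheory.DiophantineGeometry.rad a b c : ℕ) : ℝ) ^ (1 + ε / 3)) ^
          (1 - ε / 3)⁻¹ =
        K₂ ^ (1 - ε / 3)⁻¹ * ((Literature.NumberTheory.DiophantineGeometry.rad a b c : ℕ) : ℝ) ^
          ((1 + ε / 3) * (1 - ε / 3)⁻¹) := by
      rw [Real.mul_rpow hK₂.le hR3.le, ← Real.rpow_mul hR0]
    have hexp : ((Literature.NumberTheory.DiophantineGeometry.rad a b c : ℕ) : ℝ) ^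
          ((1 + ε / 3) * (1 - ε / 3)⁻¹) ≤
        ((Literature.NumberTheory.DiophantineGeometry.rad a b c : ℕ) : ℝ) ^ (1 + ε) :=
      Real.rpow_le_rpow_of_exponent_le hR hexpo
    have hK₂' : 0 ≤ K₂ ^ (1 - ε / 3)⁻¹ := (Real.rpow_pos_of_pos hK₂ _).le
    calc (c : ℝ) = ((c : ℝ) ^ (1 - ε / 3)) ^ (1 - ε / 3)⁻¹ := hroot
      _ < (K₂ * ((Literature.NumberTheory.DiophantineGeometry.rad a b c : ℕ) : ℝ) ^ (1 + ε / 3)) ^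
            (1 - ε / 3)⁻¹ := hstep
      _ = K₂ ^ (1 - ε / 3)⁻¹ * ((Literature.NumberTheory.DiophantineGeometry.rad a b c : ℕ) : ℝ) ^
            ((1 + ε / 3) * (1 - ε / 3)⁻¹) := hsplit
      _ ≤ K₂ ^ (1 - ε / 3)⁻¹ *
            ((Literature.NumberTheory.DiophantineGeometry.rad a b c : ℕ) : ℝ) ^ (1 + ε) :=
          mul_le_mul_of_nonneg_left hexp hK₂'
      _ ≤ max K₁ (K₂ ^ (1 - ε / 3)⁻¹) *
            ((Literature.NumberTheory.DiophantineGeometry.rad a b c : ℕ) : ℝ) ^ (1 + ε) :=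
          mul_le_mul_of_nonneg_right (le_max_right _ _) hRpos.le

end Summit.ABC.ABC.Theses.RootDecompD
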